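import Literature.AlgebraicGeometry.HodgeTheory.QuaternionicQuarticFamily
import Mathlib.RingTheory.Polynomial.Eisenstein.Criterion
import Mathlib.Algebra.MvPolynomial.Equiv
import Mathlib.Algebra.MvPolynomial.Division
import Mathlib.Logic.Equiv.Fin.Rotate
import HarnessLib

/-!
# The quaternionic quartic form `x₃⁴ x₂^{2e} − c (σc)³ ((x₀ − x₁) ψ)²` is IRREDUCIBLE (Eisenstein at the prime `c`), over any field

Layer `Literature/AlgebraicGeometry/HodgeTheory`. THEOREMS only (no definition, no named fact). Written by the prover seat
`hodge-nonav-19716-p2` (g12, cell `hodge-nonav`) as brick **QF-1a «EISENSTEIN-Q»** — the algebraic heart of QF-1 «COVER» (integrality and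
GEOMETRIC integrality of the generic fibre of the universal quaternionic quartic) in prover-Bx's programme Q-FAMILY (memo
`PROGRAMME-Q-FAMILY-Bx-g18.md` §6) for route `HodgeConjecture/Q8SymplecticPowers` (crux K1Q, stmt-HodgeConjecture-24190).

For a field `L` and ternary forms `c, ψ ∈ L[x₀,x₁,x₂]`, the form of `Q8Family.quarticForm`,
`Q = x₃⁴·x₂^{2e} − c·(σc)³·((x₀ − x₁)ψ)²` (`σ` the swap of `x₀, x₁`), read as a polynomial in `x₃` over `B = L[x₀,x₁,x₂]`, is
`u·X⁴ − v` with `u = x₂^{2e}`, `v = c·w`, `w = (σc)³((x₀−x₁)ψ)²`. If `c` is PRIME in `B` and does not divide `x₂`, `σc`, `x₀ − x₁`, `ψ`,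
then `u ∉ (c)`, `v ∈ (c) ∖ (c²)`; if moreover `x₂` does not divide `c`, `σc`, `ψ`, then `gcd(u, v) = 1` (`u` is a power of the prime
`x₂`), i.e. `u·X⁴ − v` is primitive — so Eisenstein's criterion (Mathlib `Polynomial.irreducible_of_eisenstein_criterion`) gives
irreducibility in `B[X]`, transported to `L[x₀,…,x₃]` along `x₃ ↦ X`, `xᵢ ↦ C xᵢ` (`rename (finRotate 4)` then `finSuccEquiv`).

* `not_dvd_of_eval_ne_zero` — `q ∤ p` as soon as some zero of `q` is not a zero of `p` (the device for the side conditions);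
  `not_X_two_dvd_X_zero_sub_X_one` — `x₂ ∤ x₀ − x₁`.
* `irreducible_C_mul_X_pow_sub_C` — Eisenstein for the binomial `u X⁴ − v` over a domain: `c` prime, `c ∤ u`, `c ∣ v`, `c² ∤ v`,
  and every common divisor of `u, v` a unit ⇒ irreducible.
* `finSuccEquiv_rename_finRotate_X_last`, `finSuccEquiv_rename_finRotate_rename_castSucc`, `finSuccEquiv_rename_finRotate_quarticShape` —
  the transport `x₃ ↦ X`, `xᵢ ↦ C xᵢ` and the image `C(x₂^{2e}) X⁴ − C v` of the form.
* **`irreducible_quarticShape`** — any field `L`: under the seven non-divisibility side conditions and `Prime c`, the form is irreducible in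
  `L[x₀,…,x₃]`; **`irreducible_quarticForm`** — the case `L = ℂ`, literally `Irreducible (Q8Family.quarticForm e c ψ)`.

The side conditions hold for the universal pair `(c, ψ) = (Σ a_d x^d, ψ₀ + σ^*ψ₀)` over `K = Frac ℂ[a]` and over every extension of
`K` (each is witnessed by a point of `L³` through `not_dvd_of_eval_ne_zero`, with polynomial non-vanishing conditions in `a`), whence
the generic fibre of the quaternionic quartic is integral and geometrically integral — the discharge is left to QF-1b/QF-5, which fix the
currency of the generic point. Honest scope: pure commutative algebra; nothing here bears on HC.

## References

* [Lang2002] S. Lang, Algebra, 3rd ed., GTM 211, Ch. IV §3, Eisenstein's criterion (Thm. 3.1) over a factorial ring.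
* [Kollar2007] J. Kollár, Lectures on Resolution of Singularities (2007), §3.3 (the quaternionic example's equation).
-/

noncomputable section

open MvPolynomial

namespace Literature.AlgebraicGeometry.HodgeTheory.Q8Family

universe v

variable {L : Type v} [Field L]

/-! ### Divisibility devices in `L[x₀, x₁, x₂]` -/

/-- **A zero of `q` which is not a zero of `p` witnesses `q ∤ p`** (evaluation is a ring homomorphism). [cite: Lang2002, Ch. IV §1 (evaluation homomorphism)] -/
theorem not_dvd_of_eval_ne_zero {σ : Type*} {q p : MvPolynomial σ L} (z : σ → L) (hq : eval z q = 0)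
    (hp : eval z p ≠ 0) : ¬ q ∣ p := by
  rintro ⟨r, rfl⟩
  rw [map_mul, hq, zero_mul] at hp
  exact hp rfl

/-- `x₂ ∤ x₀ − x₁` in `L[x₀,x₁,x₂]` (evaluate at `(1, 0, 0)`). [cite: Lang2002, Ch. IV §1 (evaluation homomorphism)] -/
theorem not_X_two_dvd_X_zero_sub_X_one : ¬ (X 2 : MvPolynomial (Fin 3) L) ∣ (X 0 - X 1) :=
  not_dvd_of_eval_ne_zero (fun i ↦ if i = 0 then 1 else 0) (by simp) (by simp)

/-! ### Eisenstein for the binomial `u X⁴ − v` -/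

/-- **Eisenstein's criterion for `u X⁴ − v` over a domain `B`**: if `c ∈ B` is prime, `c ∤ u`, `c ∣ v`, `c² ∤ v`, and every common
divisor of `u` and `v` is a unit, then `C u * X ^ 4 - C v` is irreducible in `B[X]`. [cite: Lang2002, Ch. IV §3 Thm. 3.1] -/
theorem irreducible_C_mul_X_pow_sub_C {B : Type*} [CommRing B] [IsDomain B] {c u v : B} (hc : Prime c)
    (hcu : ¬ c ∣ u) (hcv : c ∣ v) (hc2v : ¬ c * c ∣ v) (hprim : ∀ r : B, r ∣ u → r ∣ v → IsUnit r) :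
    Irreducible (Polynomial.C u * Polynomial.X ^ 4 - Polynomial.C v) := by
  classical
  have hu0 : u ≠ 0 := fun h ↦ hcu (h ▸ dvd_zero c)
  have hlt : (Polynomial.C v).degree < (Polynomial.C u * Polynomial.X ^ 4).degree := by
    rw [Polynomial.degree_C_mul_X_pow 4 hu0]
    exact lt_of_le_of_lt Polynomial.degree_C_le (by exact_mod_cast Nat.zero_lt_succ 3)
  have hdeg : (Polynomial.C u * Polynomial.X ^ 4 - Polynomial.C v).degree = 4 := by
    rw [Polynomial.degree_sub_eq_left_of_degree_lt hlt, Polynomial.degree_C_mul_X_pow 4 hu0]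
    rfl
  have hlead : (Polynomial.C u * Polynomial.X ^ 4 - Polynomial.C v).leadingCoeff = u := by
    rw [Polynomial.leadingCoeff_sub_of_degree_lt hlt, Polynomial.leadingCoeff_C_mul_X_pow]
  have hcoeff : ∀ n, (Polynomial.C u * Polynomial.X ^ 4 - Polynomial.C v).coeff n =
      (if n = 4 then u else 0) - (if n = 0 then v else 0) := by
    intro n
    rw [Polynomial.coeff_sub, Polynomial.coeff_C_mul_X_pow, Polynomial.coeff_C]
  refine Polynomial.irreducible_of_eisenstein_criterion (P := Ideal.span {c})
    ((Ideal.span_singleton_prime hc.ne_zero).mpr hc) ?_ ?_ ?_ ?_ ?_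
  · -- leading coefficient `u ∉ (c)`
    rw [hlead, Ideal.mem_span_singleton]
    exact hcu
  · -- lower coefficients in `(c)`
    intro n hn
    rw [hdeg] at hn
    have hn4 : n < 4 := by exact_mod_cast hn
    rw [hcoeff n, if_neg (by omega)]
    by_cases h0 : n = 0
    · rw [if_pos h0, zero_sub, Ideal.neg_mem_iff, Ideal.mem_span_singleton]
      exact hcv
    · rw [if_neg h0, sub_zero]
      exact Ideal.zero_mem _
  · rw [hdeg]; exact_mod_cast Nat.zero_lt_succ 3
  · -- constant term `-v ∉ (c²)`
    rw [hcoeff 0, if_neg (by omega), if_pos rfl, zero_sub, Ideal.neg_mem_iff, Ideal.span_singleton_pow,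
      Ideal.mem_span_singleton, pow_two]
    exact hc2v
  · -- primitive
    intro r hr
    rw [Polynomial.C_dvd_iff_dvd_coeff] at hr
    have h4 := hr 4
    have h0 := hr 0
    rw [hcoeff 4, if_pos rfl, if_neg (by omega), sub_zero] at h4
    rw [hcoeff 0, if_neg (by omega), if_pos rfl, zero_sub, dvd_neg] at h0
    exact hprim r h4 h0

/-! ### The transport `L[x₀,…,x₃] ≃ L[x₀,x₁,x₂][X]`, `x₃ ↦ X` -/

/-- Under `rename (finRotate 4)` followed by `finSuccEquiv`, the LAST variable `x₃` goes to the polynomial variable `X`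
(`L[x₀,…,x₃] = L[x₀,x₁,x₂][x₃]`). [cite: Lang2002, Ch. IV §1 (polynomials in several variables as iterated polynomial rings)] -/
theorem finSuccEquiv_rename_finRotate_X_last :
    finSuccEquiv L 3 (rename (finRotate 4) (X (Fin.last 3) : MvPolynomial (Fin 4) L)) = Polynomial.X := by
  rw [rename_X, finRotate_last]
  exact finSuccEquiv_X_zero

/-- Under the same transport a polynomial in `x₀, x₁, x₂` (embedded by `Fin.castSucc`) goes to the CONSTANT `C p`.
[cite: Lang2002, Ch. IV §1 (polynomials in several variables as iterated polynomial rings)] -/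
theorem finSuccEquiv_rename_finRotate_rename_castSucc (p : MvPolynomial (Fin 3) L) :
    finSuccEquiv L 3 (rename (finRotate 4) (rename Fin.castSucc p)) = Polynomial.C p := by
  rw [rename_rename]
  have hrot : ((finRotate 4) ∘ Fin.castSucc : Fin 3 → Fin 4) = Fin.succ := by
    funext i
    fin_cases i <;> rfl
  rw [hrot]
  have key : ((finSuccEquiv L 3 : MvPolynomial (Fin (3 + 1)) L →ₐ[L] Polynomial (MvPolynomial (Fin 3) L)).comp
      (rename Fin.succ)) = (Polynomial.CAlgHom : MvPolynomial (Fin 3) L →ₐ[L] Polynomial (MvPolynomial (Fin 3) L)) := by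
    refine algHom_ext fun j ↦ ?_
    rw [AlgHom.comp_apply, rename_X]
    exact finSuccEquiv_X_succ
  exact congrArg (fun φ : MvPolynomial (Fin 3) L →ₐ[L] Polynomial (MvPolynomial (Fin 3) L) ↦ φ p) key

/-- **The transported form**: `x₃⁴·x₂^{2e} − ι(v) ↦ C(x₂^{2e})·X⁴ − C v`.
[cite: Lang2002, Ch. IV §1 (polynomials in several variables as iterated polynomial rings)] -/
theorem finSuccEquiv_rename_finRotate_quarticShape (e : ℕ) (v : MvPolynomial (Fin 3) L) :
    finSuccEquiv L 3 (rename (finRotate 4)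
      (X (Fin.last 3) ^ 4 * X (Fin.castSucc 2) ^ (2 * e) - rename Fin.castSucc v : MvPolynomial (Fin 4) L)) =
      Polynomial.C (X 2 ^ (2 * e)) * Polynomial.X ^ 4 - Polynomial.C v := by
  have h3 : (X (Fin.castSucc 2) : MvPolynomial (Fin 4) L) = rename Fin.castSucc (X 2) := by rw [rename_X]
  rw [h3, map_sub, map_mul, map_pow, map_pow, map_sub, map_mul, map_pow, map_pow,
    finSuccEquiv_rename_finRotate_X_last, finSuccEquiv_rename_finRotate_rename_castSucc,
    finSuccEquiv_rename_finRotate_rename_castSucc, Polynomial.C_pow, mul_comm]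

/-! ### The quaternionic quartic is irreducible -/

/-- **The quaternionic quartic form is irreducible (Eisenstein at the prime `c`)** — any field `L`.  Let `c, ψ ∈ L[x₀,x₁,x₂]` with
`c` PRIME, `c ∤ x₂`, `c ∤ σc`, `c ∤ (x₀ − x₁)`, `c ∤ ψ` and `x₂ ∤ c`, `x₂ ∤ σc`, `x₂ ∤ ψ` (`σ` = swap of `x₀, x₁`).  Then
`x₃⁴·x₂^{2e} − c·(σc)³·((x₀ − x₁)ψ)²` is irreducible in `L[x₀,…,x₃]`: as `u X⁴ − v` over `B = L[x₀,x₁,x₂]` (`u = x₂^{2e}`, `v = c·w`) it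
satisfies Eisenstein's criterion at `(c)` — `u ∉ (c)`, `v ∈ (c)`, `v ∉ (c²)` (`c ∤ w` by primality of `c`), primitive (a common constant
divisor divides the power `u` of the prime `x₂`, and `x₂ ∤ v`). [cite: Lang2002, Ch. IV §3 Thm. 3.1] -/
theorem irreducible_quarticShape (e : ℕ) {c ψ : MvPolynomial (Fin 3) L} (hc : Prime c)
    (hcx : ¬ c ∣ X 2) (hcσ : ¬ c ∣ rename (Equiv.swap (0 : Fin 3) 1) c) (hc01 : ¬ c ∣ (X 0 - X 1)) (hcψ : ¬ c ∣ ψ)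
    (hxc : ¬ (X 2 : MvPolynomial (Fin 3) L) ∣ c) (hxσ : ¬ (X 2 : MvPolynomial (Fin 3) L) ∣ rename (Equiv.swap (0 : Fin 3) 1) c)
    (hxψ : ¬ (X 2 : MvPolynomial (Fin 3) L) ∣ ψ) :
    Irreducible (X (Fin.last 3) ^ 4 * X (Fin.castSucc 2) ^ (2 * e) -
      rename Fin.castSucc (c * rename (Equiv.swap (0 : Fin 3) 1) c ^ 3 * ((X 0 - X 1) * ψ) ^ 2) : MvPolynomial (Fin 4) L) := by
  classical
  have hx2 : Prime (X 2 : MvPolynomial (Fin 3) L) := X_prime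
  -- `c ∤ w`, `x₂ ∤ v` for `w = (σc)³((x₀−x₁)ψ)²`, `v = c w`
  have hcw : ¬ c ∣ rename (Equiv.swap (0 : Fin 3) 1) c ^ 3 * ((X 0 - X 1) * ψ) ^ 2 := by
    intro h
    rcases hc.dvd_or_dvd h with h1 | h2
    · exact hcσ (hc.dvd_of_dvd_pow h1)
    · have h3 := hc.dvd_of_dvd_pow h2
      rcases hc.dvd_or_dvd h3 with h4 | h5
      · exact hc01 h4
      · exact hcψ h5
  have hxv : ¬ (X 2 : MvPolynomial (Fin 3) L) ∣
      c * rename (Equiv.swap (0 : Fin 3) 1) c ^ 3 * ((X 0 - X 1) * ψ) ^ 2 := by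
    intro h
    rcases hx2.dvd_or_dvd h with h1 | h1
    · rcases hx2.dvd_or_dvd h1 with h2 | h2
      · exact hxc h2
      · exact hxσ (hx2.dvd_of_dvd_pow h2)
    · have h3 := hx2.dvd_of_dvd_pow h1
      rcases hx2.dvd_or_dvd h3 with h4 | h4
      · exact not_X_two_dvd_X_zero_sub_X_one h4
      · exact hxψ h4
  -- ### Eisenstein in `B[X]`
  have hirr : Irreducible (Polynomial.C ((X 2 : MvPolynomial (Fin 3) L) ^ (2 * e)) * Polynomial.X ^ 4 -
      Polynomial.C (c * rename (Equiv.swap (0 : Fin 3) 1) c ^ 3 * ((X 0 - X 1) * ψ) ^ 2)) := by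
    refine irreducible_C_mul_X_pow_sub_C hc (fun h ↦ hcx (hc.dvd_of_dvd_pow h)) ?_ ?_ ?_
    · rw [mul_assoc]; exact dvd_mul_right c _
    · rw [mul_assoc]
      exact fun h ↦ hcw ((mul_dvd_mul_iff_left hc.ne_zero).mp h)
    · intro r hru hrv
      obtain ⟨i, -, hi⟩ := (dvd_prime_pow hx2 (2 * e)).mp hru
      by_cases hi0 : i = 0
      · rw [hi0, pow_zero] at hi
        exact associated_one_iff_isUnit.mp hi
      · exfalso
        exact hxv (((dvd_pow_self (X 2) hi0).trans hi.symm.dvd).trans hrv)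
  -- ### back to `L[x₀,…,x₃]` along `x₃ ↦ X`, `xᵢ ↦ C xᵢ`
  rw [← finSuccEquiv_rename_finRotate_quarticShape e] at hirr
  have h1 := (MulEquiv.irreducible_iff (finSuccEquiv L 3).toMulEquiv).mp hirr
  exact (MulEquiv.irreducible_iff (renameEquiv L (finRotate 4)).toMulEquiv).mp h1

/-- **The quaternionic quartic form `Q8Family.quarticForm e c ψ` is irreducible over `ℂ`** under the side conditions of
`irreducible_quarticShape` (the route's form verbatim). [cite: Lang2002, Ch. IV §3 Thm. 3.1] [cite: Kollar2007, §3.3] -/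
theorem irreducible_quarticForm (e : ℕ) {c ψ : MvPolynomial (Fin 3) ℂ} (hc : Prime c)
    (hcx : ¬ c ∣ X 2) (hcσ : ¬ c ∣ rename (Equiv.swap (0 : Fin 3) 1) c) (hc01 : ¬ c ∣ (X 0 - X 1)) (hcψ : ¬ c ∣ ψ)
    (hxc : ¬ (X 2 : MvPolynomial (Fin 3) ℂ) ∣ c) (hxσ : ¬ (X 2 : MvPolynomial (Fin 3) ℂ) ∣ rename (Equiv.swap (0 : Fin 3) 1) c)
    (hxψ : ¬ (X 2 : MvPolynomial (Fin 3) ℂ) ∣ ψ) :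
    Irreducible (quarticForm e c ψ) :=
  irreducible_quarticShape e hc hcx hcσ hc01 hcψ hxc hxσ hxψ

end Literature.AlgebraicGeometry.HodgeTheory.Q8Family

end
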